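import Mathlib
import Literature.RingTheory.CompleteIntersection.NumericalCriterion
import Literature.RingTheory.CompleteIntersection.CotangentFitting
import Literature.RingTheory.CompleteIntersection.CriterionOne
import HarnessLib

/-!
# Stub `stub_numericalCriterionDVR` of line `yoshida-divisor-selmer-count`
# (crux stmt-Langlands-13639 `PhantomRMYoshida.ResiduallyYoshidaLifting`)

The Wiles–Lenstra numerical criterion over a complete DVR with ARBITRARY residue field, in the
direction used: `length_O(𝔭_A/𝔭_A²) ≤ length_O(O/η_B)` and `η_B ≠ 0` force `φ : A ↠ B` bijective.
de Smit–Rubin–Schoof 1997, Criterion I (CSS 1997 p. 343 = held PDF p. 413; proof §3 pp. 421–423).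

Registered signature is stated in RAW Mathlib vocabulary; the tree's
`Literature.RingTheory.CompleteIntersection.{congruenceIdeal, CongruenceModule, CotangentModule}`
are definitionally `Ideal.map π (ker π).annihilator`, `O ⧸ that`, `(ker (π.comp φ)).Cotangent`,
so the stub is literally the tree's unconditional
`Literature.RingTheory.CompleteIntersection.bijective_of_length_cotangentModule_le`
(file `CriterionOne`, proved for this stub: Criterion I, "`≤` ⇒ `φ` bijective", for any DVR `O`
and Noetherian local `A` — the completeness hypotheses of the registered signature are not used).
-/

namespace Summit.Langlands.Langlands.Cruxes.ResiduallyYoshidaLifting.YoshidaDivisorSelmerCount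

-- `Summit.Langlands.Langlands.…` (D-0017 layout) trips `dupNamespace` on every decl.
set_option linter.dupNamespace false
-- registered signature carries both `[IsDomain O]` and `[IsDiscreteValuationRing O]` (verbatim).
set_option linter.overlappingInstances false

/-- **STUB 2 (`stub_numericalCriterionDVR`, registered signature verbatim) — the
Wiles–Lenstra–de Smit–Rubin–Schoof numerical criterion over a complete DVR with arbitrary residue
field, direction used.** [cite: DeSmitRubinSchoof1997, Criterion I, p. 344 and §3] -/
theorem stub_numericalCriterionDVR :
    ∀ (O : Type) [CommRing O] [IsDomain O] [IsDiscreteValuationRing O]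
      [IsAdicComplete (IsLocalRing.maximalIdeal O) O]
      (A : Type) [CommRing A] [IsLocalRing A] [IsNoetherianRing A] [Algebra O A]
      [IsAdicComplete (IsLocalRing.maximalIdeal A) A]
      (B : Type) [CommRing B] [IsLocalRing B] [Algebra O B] [Module.Finite O B] [Module.Free O B]
      (φ : A →ₐ[O] B) (π : B →ₐ[O] O),
      Function.Surjective φ →
      Ideal.map (π : B →+* O) (RingHom.ker (π : B →+* O)).annihilator ≠ ⊥ →
      Module.length O (RingHom.ker ((π : B →+* O).comp (φ : A →+* B))).Cotangent ≤
        Module.length O (O ⧸ Ideal.map (π : B →+* O) (RingHom.ker (π : B →+* O)).annihilator) →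
      Function.Bijective φ := by
  intro O _ _ _ _ A _ _ _ _ _ B _ _ _ _ _ φ π hφ hη hle
  exact Literature.RingTheory.CompleteIntersection.bijective_of_length_cotangentModule_le φ π hφ
    hη hle

end Summit.Langlands.Langlands.Cruxes.ResiduallyYoshidaLifting.YoshidaDivisorSelmerCount
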